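import Summits.CriticalPhenomena.PercolationContinuityZ3.Theorems.Transplant.PlanarSkeletonFrmQuasiDefs
import Summits.CriticalPhenomena.PercolationContinuityZ3.Theorems.Transplant.SkelFrmQuasiBChoiceRootRunY
import Summits.CriticalPhenomena.PercolationContinuityZ3.Theorems.Transplant.SkelFrmBChoiceRootRunY
import Summits.CriticalPhenomena.PercolationContinuityZ3.Theorems.Transplant.SkelPhiRootClearY4
import Summits.CriticalPhenomena.PercolationContinuityZ3.Theorems.Transplant.SkelFrmQuasi1ChoiceDefs
import Summits.CriticalPhenomena.PercolationContinuityZ3.Theorems.Transplant.SkelFrmQuasi1ParamsLBL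
import Summits.CriticalPhenomena.PercolationContinuityZ3.Theorems.Transplant.SkelFrmQuasiBParamsCorrKG
import Summits.CriticalPhenomena.PercolationContinuityZ3.Theorems.Transplant.SkelFrmQuasiBParamsCorrKG0
import Summits.CriticalPhenomena.PercolationContinuityZ3.Theorems.Transplant.SkelFrmQuasiBParamsCorrKGLen3
import Summits.CriticalPhenomena.PercolationContinuityZ3.Theorems.Transplant.SkelFrmQuasiBParamsCorrKGY
import Summits.CriticalPhenomena.PercolationContinuityZ3.Theorems.Transplant.SkelFrmQuasiBParamsLF
import HarnessLib
import Summits.CriticalPhenomena.PercolationContinuityZ3.Theorems.Transplant.SkelFrmBChoiceRootClearR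
/-!
# GEN-Q PORT (WAVE-Q table v0.8 section 2, row G146, U-level L?; captain R-6/R-7 2026-08-27: carrier token swap `PlanarSkeletonFrmFrom ↦ PlanarSkeletonFrmQuasi`)
# of the tree module «Transplant/SkelFrmFromBChoiceRootClearR» (sha256 fddbe695cd99d0df…) onto the quasi-step carrier `PlanarSkeletonFrmQuasi` (p507026): «SkelFrmQuasiBChoiceRootClearR»

ORIGINAL TITLE: N2 (frames-only node `SamePDropOfSkeletonFrm₁`, OPEN), (R) column SECOND axis — **THE SEED CLEARANCE `hclear₃` OF THE ROOT'S y′-CORRIDOR,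

builds on p205010 (kernel theorem, internal audit signed; external expert review pending) — nothing in this file uses p205010; NOTHING is claimed about any open node
((N3-b), the end state).  Lane `prim-bschramm`, seat `prim-hp-8` (gen 62; GEN-Q pen, family BChoiceRoot*/1Root*/BParamsKit·Bridge; tool = captain gen-1 g4's port_genq.py R-14 + p3-g30 T1/T2 + stmt-g33 --force-keep).  Helper file (`--supports stmt-CriticalPhenomena-4575 --as helper`).
PORT RULES (U-wave r1–r4 re-used, GEN-Q hunk classes of p3-g29 #6136): declaration order, names and proof texts are those of «SkelFrmFromBChoiceRootClearR», byte-identical except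
(i) the carrier token `PlanarSkeletonFrmFrom ↦ PlanarSkeletonFrmQuasi` in binders, `namespace`/`end` lines and qualified names (module names `SkelFrmFrom… ↦ SkelFrmQuasi…`
in imports of already-ported rows); (ii) `Φ.step ↦ Φ.qstep` with the called Steps lemma replaced by its `…Q`/`_q` twin and the cost `Φ.M` threaded (none in this file unless
listed below); (iii) `Φ.cyl_connected ↦ Φ.cyl_reach` readers (none unless listed); (iv) graph-ball radii / window floors ×`Φ.M` (none unless listed).  Carrier-free
residents stay imported/exported from the original «SkelFrmBChoiceRootClearR» exactly as in the FrmFrom port.  Docstrings and citations are the original's.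

-/

noncomputable section

open scoped Classical

namespace Summit.CriticalPhenomena.PercolationContinuityZ3.Theorems.Transplant

namespace PlanarSkeletonFrmQuasi

namespace NegB

open Literature.Probability.Percolation Literature.Probability.LatticeModels SimpleGraph
open SkelConc (Consts)
open Skelφ (rootFrame shearUnit kgSL kgSLY kgΔY kgNY KGYRows kgFarY kgXY kgM₁Y kgM₂Y)
open Neg

namespace KS

section ClearR

variable (κ : Consts) {V : Type} [DecidableEq V] [Countable V] {G : SimpleGraph V} [G.LocallyFinite] (Φ : PlanarSkeletonFrmQuasi G) (t : V) (p : unitInterval)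
  (D : Skelφ.StepI.DataNS V) (mk g f qxY WxY : ℕ)

/-- **`20·K·sL ≤ pitchY`** (`pitchY = ⌊20K·m/U⌋`, `m > n_Lℓ_L − n_L ≥ n_Lℓ_L − U`, so `m/U ≥ sL`). [folklore] -/
theorem pitchY_ge (κ : Consts) {V : Type} [DecidableEq V] [Countable V] {G : SimpleGraph V} [G.LocallyFinite] (Φ : PlanarSkeletonFrmQuasi G) (t : V) (p : unitInterval) (D : Skelφ.StepI.DataNS V) (g : ℕ) (f : ℕ) (hN : EqNumL κ Φ t p D g f) : 20 * (Neg.K κ : ℤ) * (kgSL (nL κ Φ t p D g f) (ℓL κ Φ t p D g f) (hL κ Φ t p D g f)) ≤ pitchY κ Φ t p D g f := by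
  obtain ⟨hn1, -⟩ := one_le_of_eqNumL κ Φ t p D g f hN
  have hm := (Skelφ.NegPrm.modulus_vβOf hn1 (hL κ Φ t p D g f) (ℓL κ Φ t p D g f) (vL κ Φ t p D g f)).1
  have hU : (0 : ℤ) < ((shearUnit (nL κ Φ t p D g f) (hL κ Φ t p D g f) : ℕ) : ℤ) := Skelφ.shearUnit_pos hn1 _
  have hK0 : (0 : ℤ) ≤ (Neg.K κ : ℤ) := by positivity
  have hvβ : vβL κ Φ t p D g f = Skelφ.NegPrm.vβOf (nL κ Φ t p D g f) (hL κ Φ t p D g f) (ℓL κ Φ t p D g f) (vL κ Φ t p D g f) := rfl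
  have hUn : ((nL κ Φ t p D g f : ℤ)) ≤ ((shearUnit (nL κ Φ t p D g f) (hL κ Φ t p D g f) : ℕ) : ℤ) := by
    unfold Skelφ.shearUnit; push_cast
    have : (((hL κ Φ t p D g f)).natAbs : ℤ) = |(hL κ Φ t p D g f)| := Int.natCast_natAbs _
    have := abs_nonneg (hL κ Φ t p D g f); linarith
  unfold pitchY
  rw [hvβ]
  set m := TwoAxis.Para.modulus ((nL κ Φ t p D g f : ℤ)) (hL κ Φ t p D g f) (vL κ Φ t p D g f) (Skelφ.NegPrm.vβOf (nL κ Φ t p D g f) (hL κ Φ t p D g f) (ℓL κ Φ t p D g f) (vL κ Φ t p D g f)) with hm'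
  -- sL ≤ m / U
  have h1 : (kgSL (nL κ Φ t p D g f) (ℓL κ Φ t p D g f) (hL κ Φ t p D g f)) ≤ m / ((shearUnit (nL κ Φ t p D g f) (hL κ Φ t p D g f) : ℕ) : ℤ) := by
    unfold kgSL
    exact Int.ediv_le_ediv hU (by linarith)
  -- 20K·(m/U) ≤ (20K·m)/U
  have h2 : 20 * (Neg.K κ : ℤ) * (m / ((shearUnit (nL κ Φ t p D g f) (hL κ Φ t p D g f) : ℕ) : ℤ)) ≤ (20 * (Neg.K κ : ℤ) * m) / ((shearUnit (nL κ Φ t p D g f) (hL κ Φ t p D g f) : ℕ) : ℤ) := by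
    rw [Int.le_ediv_iff_mul_le hU]
    have := Int.ediv_mul_le m (ne_of_gt hU)
    nlinarith
  nlinarith

/-- **THE ROOT y′-CORRIDOR'S PARKING ROW FLOOR**: `(N+1)·sL − q − (N+1)R′ − (m₁Y^R(N)+1)·R′ ≥ kgTgtY0 − sL − ΔY₀ − 2·XY^C(N) + 1` at `N := kgNYv0`
(`XY^R ≥ q + (N+1)R′ + (m₁Y+1)R′`, `XY^R ≤ XY^C`, `(N+1)sL = farY^C − XY^C > kgTgtY0 − sL − ΔY₀ − XY^C`). [this work] -/
theorem runFloorY_R (κ : Consts) {V : Type} [DecidableEq V] [Countable V] {G : SimpleGraph V} [G.LocallyFinite] (Φ : PlanarSkeletonFrmQuasi G) (t : V) (p : unitInterval) (D : Skelφ.StepI.DataNS V) (mk : ℕ) (g : ℕ) (f : ℕ) (qxY : ℕ) (WxY : ℕ) (hN : EqNumL κ Φ t p D g f) (hg : gFloorKG κ Φ t p D mk ≤ g) (h0 : (kgFarY (nL κ Φ t p D g f) (ℓL κ Φ t p D g f) (hL κ Φ t p D g f) (vL κ Φ t p D g f) (kgR κ Φ t p D mk) 0 (kgqY κ Φ t p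 D g f qxY) (kgWY κ Φ t p D g f WxY) 0) ≤ (kgTgtY0 κ Φ t p D g f mk)) :
    (kgTgtY0 κ Φ t p D g f mk) - (kgSLY (nL κ Φ t p D g f) (ℓL κ Φ t p D g f) (hL κ Φ t p D g f)) - kgΔY (kgR κ Φ t p D mk) 0 - 2 * (kgXY (nL κ Φ t p D g f) (ℓL κ Φ t p D g f) (hL κ Φ t p D g f) (vL κ Φ t p D g f) (kgR κ Φ t p D mk) 0 (kgqY κ Φ t p D g f qxY) (kgWY κ Φ t p D g f WxY) (kgNYv0 κ Φ t p D g f mk qxY WxY)) + 1 ≤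
      ((((kgNYv0 κ Φ t p D g f mk qxY WxY) : ℕ) : ℤ) + 1) * (kgSLY (nL κ Φ t p D g f) (ℓL κ Φ t p D g f) (hL κ Φ t p D g f)) - (kgqY κ Φ t p D g f qxY) - ((((kgNYv0 κ Φ t p D g f mk qxY WxY) : ℕ) : ℤ) + 1) * (kgR κ Φ t p D mk) - (((((kgM₁Y (nL κ Φ t p D g f) (vL κ Φ t p D g f) (kgR κ Φ t p D mk) 0 (kgWY κ Φ t p D g f (KS.WxYR κ Φ t p D mk g f WxY)) (kgNYv0 κ Φ t p D g f mk qxY WxY))) : ℕ) : ℤ) + 1) * (kgR κ Φ t p D mk) := by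
  have HC := (kgYRows0_of κ Φ t p D g f mk qxY WxY hN hg)
  have HR := (kgYRows0_of κ Φ t p D g f mk qxY (KS.WxYR κ Φ t p D mk g f WxY) hN hg)
  obtain ⟨-, hspec⟩ := HC.kgNY_spec h0
  have e : kgNY (nL κ Φ t p D g f) (ℓL κ Φ t p D g f) (hL κ Φ t p D g f) (vL κ Φ t p D g f) (kgR κ Φ t p D mk) 0 (kgqY κ Φ t p D g f qxY) (kgWY κ Φ t p D g f WxY) (kgTgtY0 κ Φ t p D g f mk) = (kgNYv0 κ Φ t p D g f mk qxY WxY) := rfl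
  rw [e] at hspec
  have hmono := HR.kgXY_mono_qW le_rfl (kgWY_R_le κ Φ t p D mk g f WxY) (kgNYv0 κ Φ t p D g f mk qxY WxY)
  have hXR : (((kgqY κ Φ t p D g f qxY) : ℕ) : ℤ) + ((((kgNYv0 κ Φ t p D g f mk qxY WxY) : ℕ) : ℤ) + 1) * (kgR κ Φ t p D mk) + (((((kgM₁Y (nL κ Φ t p D g f) (vL κ Φ t p D g f) (kgR κ Φ t p D mk) 0 (kgWY κ Φ t p D g f (KS.WxYR κ Φ t p D mk g f WxY)) (kgNYv0 κ Φ t p D g f mk qxY WxY))) : ℕ) : ℤ) + 1) * (kgR κ Φ t p D mk) ≤ (kgXY (nL κ Φ t p D g f) (ℓL κ Φ t p D g f) (hL κ Φ t p D g f) (vL κ Φ t p D g f) (kgR κ Φ t p D mk) 0 (kgqY κ Φ t p D g f qxY) (kgWY κ Φ t p D g f (KS.WxYR κ Φ t p D mk g f WxY)) (kgNYv0 κ Φ t p D g f mk qxY WxY)) := by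
    unfold kgXY
    have hd : (0 : ℤ) ≤ ((Skelφ.dS (nL κ Φ t p D g f) (ℓL κ Φ t p D g f) (hL κ Φ t p D g f) : ℕ) : ℤ) := by positivity
    have hR0 : (0 : ℤ) ≤ (((kgR κ Φ t p D mk) : ℕ) : ℤ) := by positivity
    have hm2 : (0 : ℤ) ≤ ((kgM₂Y (nL κ Φ t p D g f) (ℓL κ Φ t p D g f) (hL κ Φ t p D g f) (vL κ Φ t p D g f) (kgR κ Φ t p D mk) 0 (kgqY κ Φ t p D g f qxY) (kgWY κ Φ t p D g f (KS.WxYR κ Φ t p D mk g f WxY)) (kgNYv0 κ Φ t p D g f mk qxY WxY) : ℕ) : ℤ) := by positivity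
    have hN0 : (0 : ℤ) ≤ (((kgNYv0 κ Φ t p D g f mk qxY WxY) : ℕ) : ℤ) := by positivity
    push_cast
    nlinarith
  unfold kgFarY at hspec
  linarith

-- GEN-Q (R-2, captain 2026-08-27): `PlanarSkeletonFrmFrom.NegB.KS.hclear₃_R` is not in the used cone of the node top — not ported.

end ClearR

end KS

end NegB

end PlanarSkeletonFrmQuasi

end Summit.CriticalPhenomena.PercolationContinuityZ3.Theorems.Transplant

end
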